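/-
Copyright (c) 2026 the pub-hodgecm-mathlib formalisation cell (harness21).  Prover seat hodgecm-mathlib-R90-C10-p08 (g0) (free S1 hand), HCML SLAB R90-TF,
section S6 «Ch. 14.1–14.5 stable trace formula» (base `R90-C14`), S6 WAVE 3 card W3-e (R90-C14-plan (g0), R90 bus 2026-09-04T21:29:46Z; DRAFT at HOME pending the planner's re-point — dealt to R90-C14-p03).  2026-09-04.
-/
import Literature.NumberTheory.Automorphic.HyperspecialUnitarySatakeTransformAdicCompletion   -- ★ `unitaryHeckeEigencharacterAdic(_apply)`, `unitarySatakeTransformAdic_eq`, `unramifiedLocalConjDatum_localConjUniformizer`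
import Literature.NumberTheory.Automorphic.HyperspecialUnitarySatakeIsomorphismAdicCompletion  -- ★ `exists_galAdicCompletionMap_ne` (`σ_w ≠ id` at an inert place)
import Summits.HodgeConjecture.HodgeConjecture.Theorems.R90S6HeckeEigenpolyThreeExists         -- ★ p862233 (this hand, W3-c): `unitaryHeckeEigencharacterAdic_three_aeval`, `exists_generator_unitaryHeckeAlgebraAdic_three`
import Mathlib.LinearAlgebra.Lagrange                                                         -- Mathlib `Lagrange.basis`, `eval_basis_self`, `eval_basis_of_ne`
import HarnessLib

/-!
# R90 · S6 «Ch. 14.1–14.5 stable trace formula» — WAVE 3 card W3-e: unramified HECKE EIGENCHARACTERS of `U(J₀,3)(E_w)` with distinct Satake traces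
# are LINEARLY INDEPENDENT (`Theorems/R90S6HeckeEigencharactersSeparateThree.lean`)

Cell `hodgecm-mathlib`, crux H413 (`stmt-HodgeConjecture-24833`), route of record `HCCMUnconditional`; programme R90-TF, section S6 (base `R90-C14`),
seat R90-C10-p08 (g0) (free S1 hand); S6 WAVE 3 card W3-e of the sheet
`R90/R90-C14-plan/g0/S6_wave3ef_targets.v1.R90-C14-plan-g0.lean` f4d26f1db6a7ba34 :25–:33 (signature token-identical, namespace segment `.Wave3` dropped;
AUDIT S6#W3 e∕f CLEAN 21:30:09Z).  Helper lane `--supports stmt-HodgeConjecture-24833 --as helper`; THEOREMS ONLY (no definition, no instance, no notation,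
no named fact, no `sorry`); imports = ★ Literature Satake files + ★ `Theorems.R90S6HeckeEigenpolyThreeExists` (W3-c) + Mathlib `Lagrange` + HarnessLib (no Lines import).

THE PRINT [Rogawski1990, §14.5 pp. 232–236: the comparison identity holds «for all `f = ⊗ f_v` with `f_w` in the Hecke algebra» and the eigenvalue packets are
separated by varying `f_w`]; [CartierCorvallis1979, §IV Thm. 4.1, Cor. 4.2] (`ℋ(G, K) ≅ ℂ[Λ]^W`; in relative rank one `= ℂ[X]`); linear independence of
characters.  For `U(J₀,3)(E_w)` at an inert unramified `w` the spherical Hecke algebra is `ℂ[T₁]` with `𝒮_w(T₁) = x^{(1,0,-1)} + x^{(-1,0,1)}`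
(★ `exists_generator_unitaryHeckeAlgebraAdic_three`) and `λ_{(z,1,1)}(Q(T₁)) = Q(z + z⁻¹)` (★ `unitaryHeckeEigencharacterAdic_three_aeval`, W3-c p862233).  Given a
finite relation `Σ_i c_i λ_{(z_i,1,1)} = 0` on `ℋ` with pairwise distinct traces `s_i = z_i + z_i⁻¹`, test it on `Q_j(T₁)` for the LAGRANGE polynomial `Q_j` at
the nodes `s` (Mathlib `Lagrange.basis univ s j`: `Q_j(s_i) = δ_{ij}`, ★ `Lagrange.eval_basis_self` ∕ `eval_basis_of_ne`): `0 = Σ_i c_i Q_j(s_i) = c_j`.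
* **`hecke_eigencharacters_separate_three`** — W3-e (the `N = 3` twin of ★ `hecke_eigencharacters_separate_two`, W3-f p862242).
HONEST LABEL: local spherical Hecke algebra bookkeeping; proves no printed global statement.  HC_CM is proved only modulo the 7 printed
citations (2 remaining named inputs: hLiu418 = stmt-HodgeConjecture-24832, h413 = stmt-HodgeConjecture-24833) until rung 0 closes; count-neutral helper.

## Tree search
★ `unitaryHeckeEigencharacterAdic_three_aeval`, `exists_generator_unitaryHeckeAlgebraAdic_three` (p862233), ★ `hecke_eigencharacters_separate_two` (p862242, the `N = 2` twin);
Mathlib `Lagrange.basis`, `Lagrange.eval_basis_self`, `Lagrange.eval_basis_of_ne`, `Finset.sum_ite_eq`.  Dedup: `rg "hecke_eigencharacters_separate_three"` — only the sheet (R90/, not in tree).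

## References
* [Rogawski1990] J. D. Rogawski, *Automorphic Representations of Unitary Groups in Three Variables*, Ann. of Math. Stud. 123 (1990), §4.5 p. 50; §14.5 pp. 232–236.
* [CartierCorvallis1979] P. Cartier, *Representations of 𝔭-adic groups: a survey*, PSPM 33.1 (1979), §IV (4.2)–(4.4), Thm. 4.1, Cor. 4.2.
* [Minguez2011] A. Mínguez, *Unramified representations of unitary groups* (2011), §4.
-/

set_option autoImplicit false
-- the mandated namespace repeats the single-problem summit's segment (`HodgeConjecture.HodgeConjecture`)
set_option linter.dupNamespace false

noncomputable section

open NumberField IsDedekindDomain Polynomial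
open Literature.NumberTheory.Automorphic Literature.NumberTheory.Automorphic.HermitianLattice Literature.NumberTheory.Automorphic.UnitaryGroup

namespace Summit.HodgeConjecture.HodgeConjecture.R90.S6

variable {F E : Type} [Field F] [NumberField F] [Field E] [NumberField E] [Algebra F E] [Algebra.IsQuadraticExtension F E]
  (c : E ≃ₐ[F] E) (hc1 : c ≠ 1) (v : HeightOneSpectrum (𝓞 F)) (w : PlacesOver E v) (hw : c • w.1 = w.1)
  (hv : Algebra.IsUnramifiedIn (𝓞 E) v.asIdeal)

/-! ## W3-e -/

/-- **W3-e — unramified Hecke eigencharacters of `U(J₀,3)(E_w)` with pairwise distinct Satake traces are linearly independent**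
[Rogawski1990, §14.5 pp. 232–236; CartierCorvallis1979 §IV Thm. 4.1, Cor. 4.2]: if `Σ_i c_i · λ_{(z_i,1,1)}(φ) = 0` for EVERY `φ ∈ ℋ(U(J₀,3)(E_w), K₀)` and
the traces `z_i + z_i⁻¹` are pairwise distinct, then every `c_i = 0` — test the relation on `Q_j(T₁)` with `Q_j` the Lagrange polynomial at the nodes
`s_i = z_i + z_i⁻¹` (`λ_{(z_i,1,1)}(Q_j(T₁)) = Q_j(s_i) = δ_{ij}`, ★ W3-c).  (Sheet `S6_wave3ef_targets.v1` :25–:33 token-for-token; supply lemma for the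
«linear independence of Hecke characters» step of the (14.5.1) Hecke variation.)
[cite: Rogawski1990, §14.5 pp. 232–236] [cite: CartierCorvallis1979, §IV Thm. 4.1, Cor. 4.2] [cite: Minguez2011, §4] -/
theorem hecke_eigencharacters_separate_three {n : ℕ} (z : Fin n → ℂˣ) (coef : Fin n → ℂ)
    (hz : ∀ i j : Fin n, i ≠ j → (z i : ℂ) + (z i : ℂ)⁻¹ ≠ (z j : ℂ) + (z j : ℂ)⁻¹)
    (hrel : ∀ φ : heckeAlgebra ℂ ↥(unitaryGroupOfForm (galAdicCompletionMap (L := E) c hw) ((StdForm.antidiagonal 3).over (w.1.adicCompletion E)))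
        (unitaryInt (galAdicCompletionMap (L := E) c hw) ((StdForm.antidiagonal 3).over (w.1.adicCompletion E))),
      ∑ i : Fin n, coef i * unitaryHeckeEigencharacterAdic c hc1 v w hw hv ![z i, 1, 1] φ = 0) :
    ∀ i : Fin n, coef i = 0 := by
  classical
  obtain ⟨T₁, hT₁, -⟩ := exists_generator_unitaryHeckeAlgebraAdic_three c hc1 v w hw hv
  -- the nodes `s_i = z_i + z_i⁻¹`, pairwise distinct
  set s : Fin n → ℂ := fun i => (z i : ℂ) + (z i : ℂ)⁻¹ with hs
  have hinj : Set.InjOn s (Finset.univ : Finset (Fin n)) := by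
    intro i _ j _ hij
    by_contra hne
    exact hz i j hne hij
  intro j
  -- test the relation on the Lagrange polynomial `Q_j` at the nodes: `λ_{(z_i,1,1)}(Q_j(T₁)) = Q_j(s_i) = δ_{ij}`
  have h := hrel (aeval T₁ (Lagrange.basis Finset.univ s j))
  simp only [unitaryHeckeEigencharacterAdic_three_aeval c hc1 v w hw hv hT₁] at h
  have hδ : ∀ i : Fin n, (Lagrange.basis Finset.univ s j).eval ((z i : ℂ) + (z i : ℂ)⁻¹) = if j = i then 1 else 0 := by
    intro i
    change (Lagrange.basis Finset.univ s j).eval (s i) = _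
    split_ifs with hji
    · subst hji
      exact Lagrange.eval_basis_self hinj (Finset.mem_univ j)
    · exact Lagrange.eval_basis_of_ne hji (Finset.mem_univ i)
  simp only [hδ, mul_ite, mul_one, mul_zero, Finset.sum_ite_eq, Finset.mem_univ, if_true] at h
  exact h

end Summit.HodgeConjecture.HodgeConjecture.R90.S6

end
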